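import Summits.BirchSwinnertonDyer.BirchSwinnertonDyer.Theorems.TwoAdicConverseLambdaHalfInstances
import Summits.BirchSwinnertonDyer.BirchSwinnertonDyer.Theorems.ByReductionTypeAtTwoOrdEisensteinHalfShaCurrency
import Summits.BirchSwinnertonDyer.BirchSwinnertonDyer.Theorems.ByReductionTypeAtTwoOrdRedClass222339b
import Summits.BirchSwinnertonDyer.BirchSwinnertonDyer.Theorems.ByReductionTypeAtTwoOrdRedClass446331c
import HarnessLib

/-!
# Route `TwoAdicConverse` (rung S3), crux `OrdLambdaHalfAtTwo` (item 19556): item 19556's leaf BY NAME at the two `open2tors`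
# classes **222339b**, **446331c** that had NO S3 row — through the K4 ORD-RED road (ord GEN 11) and Mazur's `2`-adic IMC

Cell `bsd-2adic` (run/shared/lean/pub/bsd-2adic/), seat `bsd-2adic-conv-1x` (WIDTH-LEVER second lane on item 19556, GEN 2). THEOREMS ONLY.
conv-1x GEN 0's residue «31 classes without any S3 row» = 29 λ-saturated `E[2]`-irreducible classes + these two rational-`2`-torsion classes
(222339b, 446331c: no certified tower gap, and — this GEN's census search, kit j280944 — no congruent certified anchor either). The K4 lane's
ORD-RED class files (`Theorems/ByReductionTypeAtTwoOrdRedClass{222339b,446331c}.lean`, 2026-08-27) put the Kato–Néron half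
`O1.MainConjectureLowerDivisibilityAtTwoOrd` at them BY NAME (MEMO-7 binder `hB7` + PUB/PRINT) and `BSD(E,2)` from the CT2 certificate
`2⁴ ∣ #Ш`, `#Ш_an = 16`; ord-3's `EisensteinShaCurrency.mazurMainConjecture_two_of_katoHalf_of_missingLowerBoundAt` turns Kato half + the
ONE-SIDED `Ш` lower bound (+ Greenberg 4.1@2, GZK, modularity, `r_an = 0`) into Mazur's IMC, and conv-1's `lambdaHalfAtTwo_of_mazurMainConjecture`
into item 19556's leaf. BY-NAME species (Kato 17.4@2 inside; MEMO token `hB7`): these rows are STRUCTURE (no S3 row is booked), they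
only remove the two classes from the «no S3 row» list (31 → 29 = exactly the λ-saturated irreducible block). HONEST FRAMING: item 19556
stays OPEN at the `∀`-level; BSD is not proved by any of this. PARTITION (D-0054): none — RANK axis (S3); companion formula cell X5@2
good-ord `open2tors` (ORD-RED habitat); types-the-object-of; closes none; bears_on: S3 (19556), K4 FYI (19573/19271 ORD-RED).
-/

set_option linter.dupNamespace false
set_option autoImplicit false

noncomputable section

open scoped Classical MatrixGroups ModularForm
open CongruenceSubgroup WeierstrassCurve Literature.NumberTheory.EllipticCurves
  Literature.NumberTheory.EllipticCurves.ModularForms Literature.NumberTheory.EllipticCurves.Rank1Residual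
  Literature.NumberTheory.EllipticCurves.Rank1Residual.Typed
  Literature.NumberTheory.EllipticCurves.Greenberg1999
  Summit.BirchSwinnertonDyer.BirchSwinnertonDyer.Theorems.Rank1ResidualX1Defs
  Summit.BirchSwinnertonDyer.Rank1Residual.X5 Summit.BirchSwinnertonDyer.Rank1Residual.X5.O1 Summit.BirchSwinnertonDyer.Rank1Residual
  Summit.BirchSwinnertonDyer.BirchSwinnertonDyer.Theorems
  Summit.BirchSwinnertonDyer.BirchSwinnertonDyer.Theorems.OrdKatoIntAtTwo
  Summit.BirchSwinnertonDyer.BirchSwinnertonDyer.Theorems.OrdKatoOptimalAtTwo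
  Summit.BirchSwinnertonDyer.BirchSwinnertonDyer.Theorems.OrdRedAtTwo

namespace Summit.BirchSwinnertonDyer.BirchSwinnertonDyer.Theorems.TwoAdicTwistConverse

/-! ## Class `222339b` (member `222339b1`, one rational point of order `2`, `#Ш_an = 16`, `λ_an = 9`) -/

/-- **Item 19556's leaf AT `222339b1`, BY NAME, on the K4 ORD-RED road** (seat bsd-2adic-ord GEN 11, `Theorems/ByReductionTypeAtTwoOrdRedClass222339b.lean`):
the ORD-RED Kato–Néron half `mainConjectureLowerDivisibilityAtTwoOrd_222339b1_ordRed` (MEMO binder `hB7` = `KatoMuPartAtOptimalMemberOfNotSurjectiveTwo` +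
PUB/PRINT {`hmod`, `hGZK`, `h17` (∀-form), `hGr`, `hCassels`} + RECORD `hr`) and the CT2 lower-bound certificate (`hShaAn : #Ш_an = 16` RECORD,
`hdvd : 2⁴ ∣ #Ш` CERT-CT2-X5ALL) give Mazur's `2`-adic IMC at `222339b1` by ord-3's `EisensteinShaCurrency.mazurMainConjecture_two_of_katoHalf_of_missingLowerBoundAt`
(+ Greenberg 4.1@2 `hEC`), hence the leaf by conv-1's `lambdaHalfAtTwo_of_mazurMainConjecture`. Kato 17.4@2 INCLUDED (by-name species; this class
had NO S3 row before: rational `2`-torsion of type «prop513»/«neither», no certified tower gap, no congruent certified anchor in the census).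
[cite: Kato2004Asterisque, Thm. 17.4 (1)(2) (p. 273)] [cite: GreenbergLNM1716, Thm. 4.1 (p. 102)] [cite: Miller2011LMS, Def. 1.1] -/
theorem lambdaHalfAtTwo_222339b1_ordRed_byName
    (hB7 : KatoMuPartAtOptimalMemberOfNotSurjectiveTwo)
    (hmod : nonempty_modularParametrizationData) (hGZK : rank_eq_analyticRank_of_analyticRank_le_one)
    (h17 : ∀ (V : WeierstrassCurve ℚ) [V.IsElliptic] [V.IsGloballyMinimal] [NeZero (V.conductorNorm ℤ)]
      (f : CuspForm (Gamma0 (V.conductorNorm ℤ)) 2), kato_divisibility_allPrimes V 2 (f := f))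
    (hGr : Greenberg1999.thm41_charValue_rankZero_anyPrime) (hCassels : bsdRHS_eq_of_isIsogenous)
    (hEC : TwoAdicEulerCharRankZero OrdRedClass.c222339b1 0)
    (hr : OrdRedClass.c222339b1.analyticRank = 0) (hShaAn : shaAn OrdRedClass.c222339b1 = ((16 : ℚ) : ℂ)) (hdvd : 2 ^ 4 ∣ OrdRedClass.c222339b1.shaOrder) :
    LambdaHalfAtTwo OrdRedClass.c222339b1 :=
  lambdaHalfAtTwo_of_mazurMainConjecture OrdRedClass.c222339b1 hmod
    (EisensteinShaCurrency.mazurMainConjecture_two_of_katoHalf_of_missingLowerBoundAt OrdRedClass.c222339b1 (fun f => h17 OrdRedClass.c222339b1 f) hEC hGZK hmod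
      OrdRedClass.goodOrd_two_222339b1 hr
      (OrdRedClass.mainConjectureLowerDivisibilityAtTwoOrd_222339b1_ordRed hB7 hmod hGZK h17 hGr hCassels hr)
      (by
        have hfin : OrdRedClass.c222339b1.ShaFinite := (hGZK OrdRedClass.c222339b1 (by omega)).2
        refine ⟨16, hShaAn, ?_⟩
        rw [show (16 : ℚ) = ((2 ^ 4 : ℕ) : ℚ) by norm_num, padicValRat.of_nat, padicValNat.prime_pow]
        exact_mod_cast (padicValNat_dvd_iff_le (WeierstrassCurve.shaOrder_pos OrdRedClass.c222339b1 hfin).ne').1 hdvd))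

/-! ## Class `446331c` (member `446331c1`, one rational point of order `2`, `#Ш_an = 16`, `λ_an = 5`) -/

/-- **Item 19556's leaf AT `446331c1`, BY NAME, on the K4 ORD-RED road** (seat bsd-2adic-ord GEN 11, `Theorems/ByReductionTypeAtTwoOrdRedClass446331c.lean`):
the ORD-RED Kato–Néron half `mainConjectureLowerDivisibilityAtTwoOrd_446331c1_ordRed` (MEMO binder `hB7` = `KatoMuPartAtOptimalMemberOfNotSurjectiveTwo` +
PUB/PRINT {`hmod`, `hGZK`, `h17` (∀-form), `hGr`, `hCassels`} + RECORD `hr`) and the CT2 lower-bound certificate (`hShaAn : #Ш_an = 16` RECORD,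
`hdvd : 2⁴ ∣ #Ш` CERT-CT2-X5ALL) give Mazur's `2`-adic IMC at `446331c1` by ord-3's `EisensteinShaCurrency.mazurMainConjecture_two_of_katoHalf_of_missingLowerBoundAt`
(+ Greenberg 4.1@2 `hEC`), hence the leaf by conv-1's `lambdaHalfAtTwo_of_mazurMainConjecture`. Kato 17.4@2 INCLUDED (by-name species; this class
had NO S3 row before: rational `2`-torsion of type «prop513»/«neither», no certified tower gap, no congruent certified anchor in the census).
[cite: Kato2004Asterisque, Thm. 17.4 (1)(2) (p. 273)] [cite: GreenbergLNM1716, Thm. 4.1 (p. 102)] [cite: Miller2011LMS, Def. 1.1] -/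
theorem lambdaHalfAtTwo_446331c1_ordRed_byName
    (hB7 : KatoMuPartAtOptimalMemberOfNotSurjectiveTwo)
    (hmod : nonempty_modularParametrizationData) (hGZK : rank_eq_analyticRank_of_analyticRank_le_one)
    (h17 : ∀ (V : WeierstrassCurve ℚ) [V.IsElliptic] [V.IsGloballyMinimal] [NeZero (V.conductorNorm ℤ)]
      (f : CuspForm (Gamma0 (V.conductorNorm ℤ)) 2), kato_divisibility_allPrimes V 2 (f := f))
    (hGr : Greenberg1999.thm41_charValue_rankZero_anyPrime) (hCassels : bsdRHS_eq_of_isIsogenous)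
    (hEC : TwoAdicEulerCharRankZero OrdRedClass.c446331c1 0)
    (hr : OrdRedClass.c446331c1.analyticRank = 0) (hShaAn : shaAn OrdRedClass.c446331c1 = ((16 : ℚ) : ℂ)) (hdvd : 2 ^ 4 ∣ OrdRedClass.c446331c1.shaOrder) :
    LambdaHalfAtTwo OrdRedClass.c446331c1 :=
  lambdaHalfAtTwo_of_mazurMainConjecture OrdRedClass.c446331c1 hmod
    (EisensteinShaCurrency.mazurMainConjecture_two_of_katoHalf_of_missingLowerBoundAt OrdRedClass.c446331c1 (fun f => h17 OrdRedClass.c446331c1 f) hEC hGZK hmod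
      OrdRedClass.goodOrd_two_446331c1 hr
      (OrdRedClass.mainConjectureLowerDivisibilityAtTwoOrd_446331c1_ordRed hB7 hmod hGZK h17 hGr hCassels hr)
      (by
        have hfin : OrdRedClass.c446331c1.ShaFinite := (hGZK OrdRedClass.c446331c1 (by omega)).2
        refine ⟨16, hShaAn, ?_⟩
        rw [show (16 : ℚ) = ((2 ^ 4 : ℕ) : ℚ) by norm_num, padicValRat.of_nat, padicValNat.prime_pow]
        exact_mod_cast (padicValNat_dvd_iff_le (WeierstrassCurve.shaOrder_pos OrdRedClass.c446331c1 hfin).ne').1 hdvd))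

end Summit.BirchSwinnertonDyer.BirchSwinnertonDyer.Theorems.TwoAdicTwistConverse

end
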